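import Summits.Ventures.YMGap.RobustBall.CentreTubeAreaLaw
import Summits.Ventures.YMGap.RobustBall.CentreBlindMembers
import HarnessLib

/-!
# RobustBall/CentreTubeMembers — members of the centre tube: linkwise centre-blind actions of any size PLUS
# arbitrary (inhomogeneous, any `N`-ality) plaquette densities; bond-disordered Wilson couplings

HONEST FRAMING: venture file of the cell `pub-ymgap` (QuantumFields programme), track Y2 ROBUST-BALL, seat ds-4 g8.
WHAT THIS IS: membership lemmas for the flux-local class `IsFluxLocal a` of `CentreProjectionFlux` and the named
cells of the centre-tube area law `CentreTubeAreaLaw`: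
* `isFluxLocal_of_plaquetteFamilyAction` — every INHOMOGENEOUS plaquette action `W.total U = ∑_q f_q(U_q)`
  (`IsPlaquetteFamilyAction f W`) is flux-local with amplitude `a` as soon as `|f_q(ψ(s)·g) − m_q(g)| ≤ a` for SOME
  centring `m_q` (`m_q = const`: `a = ½ osc f_q`); adding a twist-blind (linkwise centre-blind) action of ANY size keeps
  the amplitude (`IsFluxLocal.twistBlind_add`).  WHAT IS AND IS NOT DROPPED (rb-theory T-P3): membership in the carrier
  `Perturbation` still forces every density `f_q` to be MEASURABLE, BOUNDED and a CLASS FUNCTION (gauge invariance of the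
  activity); what the tube drops is CENTRE-blindness (any `N`-ality is allowed) relative to §6(c), and the LIPSCHITZ load /
  smallness of the blind part `W_b` relative to tier 1;
* `plaqFamilyI` / `exists_plaquetteFamily_member` — inhomogeneous class-function plaquette actions exist in
  rb-theory's carrier (the `q`-dependent twin of p1/ds-4's `plaqFamily`);
* **bond disorder** (`detuneDensity δ q g = −δ_q Re tr g`): the SU(N) Wilson action with PLAQUETTE-DEPENDENT couplings
  `β + δ_q`, `|δ_q| ≤ δ`, plus any twist-blind action, is flux-local with amplitude `N δ`; hence the UNIFORM area law
  `|⟨W_{R×T}⟩| ≤ (4 c^T)^R` at `c = 2(d−1)N(|β| + δ) ≤ 1` over ALL such coupling fields (`bondDisorder_wilsonLoop_le`;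
  SU(2) `d = 4`: every plaquette coupling `β_W(q) = 2(β + δ_q)` with `2(|β| + δ) ≤ 1/8` gives `(4·(3/4)^T)^R`).
WHAT THIS IS NOT: anything at weak coupling, continuum, spectral or Clay; no string-tension existence claim.
-/

noncomputable section

open Finset
open Literature.MathematicalPhysics.QuantumLattice (fundamentalRep)
open Literature.MathematicalPhysics.QuantumFieldTheory

namespace Summit.Ventures.YMGap.RobustBall

variable {d L N : ℕ}

/-! ### Inhomogeneous plaquette actions are flux-local -/

/-- **`IsPlaquetteFamilyAction f W`**: the total perturbation is an INHOMOGENEOUS plaquette action with densities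
`f_q`, `W.total U = ∑_q f_q(U_q)` (the `q`-dependent twin of `IsPlaquetteAction`). [folklore] -/
def IsPlaquetteFamilyAction [NeZero L] (f : Plaquette d L → SUN N → ℝ) (W : Perturbation d L N) : Prop :=
  ∀ U, W.total U = ∑ q : Plaquette d L, f q (plaquetteHolonomy U q.1 q.2.1.1 q.2.1.2)

/-- A homogeneous plaquette action is a plaquette family action with constant family. [folklore] -/
theorem IsPlaquetteAction.family [NeZero L] {f : SUN N → ℝ} {W : Perturbation d L N} (h : IsPlaquetteAction f W) :
    IsPlaquetteFamilyAction (fun _ => f) W := h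

/-- **Plaquette family actions are flux-local**: if `|f_q(centreOf s · g) − m_q(g)| ≤ a` for some centring `m`, then
`W` is flux-local with amplitude `a` (twist-invariant part `c(U) = ∑_q m_q(U_q)`, defect
`g_q(s, U) = f_q(centreOf s · U_q) − m_q(U_q)`; `(ζ_k U)_q = centreOf((curl k)_q) · U_q`). [folklore] -/
theorem isFluxLocal_of_plaquetteFamilyAction [NeZero L] [NeZero N] {f : Plaquette d L → SUN N → ℝ}
    {W : Perturbation d L N} (hW : IsPlaquetteFamilyAction f W) {a : ℝ} (m : Plaquette d L → SUN N → ℝ)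
    (hm : ∀ (q : Plaquette d L) (s : ZMod N) (g : SUN N), |f q (centreOf s * g) - m q g| ≤ a) : IsFluxLocal a W := by
  refine ⟨fun U => ∑ q : Plaquette d L, m q (plaquetteHolonomy U q.1 q.2.1.1 q.2.1.2),
    fun q s U => f q (centreOf s * plaquetteHolonomy U q.1 q.2.1.1 q.2.1.2) - m q (plaquetteHolonomy U q.1 q.2.1.1 q.2.1.2),
    fun q s U => hm q s _, fun k U => ?_⟩
  rw [hW, ← Finset.sum_add_distrib]
  refine Finset.sum_congr rfl fun q _ => ?_
  rw [plaquetteHolonomy_mul_of_center _ _ (twistOf_mem_center k), plaquetteHolonomy_twistOf]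
  ring

/-- **Constant centring**: `|f_q(g) − m_q| ≤ a` for all `g` (e.g. `m_q` the mid-range of `f_q`, `a = ½ max_q osc f_q`)
makes the plaquette family action flux-local with amplitude `a`. [folklore] -/
theorem isFluxLocal_of_plaquetteFamilyAction_const [NeZero L] [NeZero N] {f : Plaquette d L → SUN N → ℝ}
    {W : Perturbation d L N} (hW : IsPlaquetteFamilyAction f W) {a : ℝ} (m : Plaquette d L → ℝ)
    (hm : ∀ (q : Plaquette d L) (g : SUN N), |f q g - m q| ≤ a) : IsFluxLocal a W :=
  isFluxLocal_of_plaquetteFamilyAction hW (fun q _ => m q) fun q _ _ => hm q _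

/-- **Homogeneous plaquette actions** `∑_q f(U_q)` with `|f(centreOf s · g) − m(g)| ≤ a` are flux-local with
amplitude `a`. [folklore] -/
theorem isFluxLocal_of_plaquetteAction [NeZero L] [NeZero N] {f : SUN N → ℝ} {W : Perturbation d L N}
    (hW : IsPlaquetteAction f W) {a : ℝ} (m : SUN N → ℝ) (hm : ∀ (s : ZMod N) (g : SUN N), |f (centreOf s * g) - m g| ≤ a) :
    IsFluxLocal a W :=
  isFluxLocal_of_plaquetteFamilyAction hW.family (fun _ => m) fun _ s g => hm s g

/-- **The tube around the centre-blind subspace**: a twist-blind action `W_b` of ANY size plus a plaquette family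
action with `|f_q(centreOf s · g) − m_q(g)| ≤ a` is flux-local with amplitude `a`. [folklore] -/
theorem isFluxLocal_twistBlind_add_plaquetteFamily [NeZero L] [NeZero N] {Wb W : Perturbation d L N}
    (hb : IsTwistBlind Wb) {f : Plaquette d L → SUN N → ℝ} (hW : IsPlaquetteFamilyAction f W) {a : ℝ}
    (m : Plaquette d L → SUN N → ℝ) (hm : ∀ (q : Plaquette d L) (s : ZMod N) (g : SUN N), |f q (centreOf s * g) - m q g| ≤ a) :
    IsFluxLocal a (Wb + W) :=
  IsFluxLocal.twistBlind_add hb (isFluxLocal_of_plaquetteFamilyAction hW m hm)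

/-! ### Inhomogeneous class-function plaquette actions exist in the carrier -/

section FamilyI

variable (f : Plaquette d L → SUN N → ℝ) (a₀ lam : ℝ) (hf : ∀ q, Continuous (f q))
  (hfconj : ∀ q (g h : SUN N), f q (h * g * h⁻¹) = f q g) (hfosc : ∀ q x y, f q x - f q y ≤ a₀) (hlam : 0 ≤ lam)
  (hflip : ∀ q x y, |f q x - f q y| ≤ lam * suFrobDist x y)

/-- The INHOMOGENEOUS family of class-function plaquette terms `q ↦ f_q(U_q)` (the `q`-dependent twin of
`plaqFamily`), each on the polymer `plaqCode q`. [folklore] -/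
def plaqFamilyI (q : Plaquette d L) : LocalTerm d L N :=
  LocalTerm.ofClass (f q) a₀ lam (hf q) (hfconj q) (hfosc q) hlam (hflip q) (plaqWord q.1 q.2.1.1 q.2.1.2)
    (plaqCode q.1 q.2.1.1 q.2.1.2) q.1 (isWalk_plaqWord q.1 q.2.1.1 q.2.1.2) fun _ hl => site_mem_plaqCode hl

/-- The activity of a term of the inhomogeneous family is `f_q(U_q)`. [folklore] -/
theorem plaqFamilyI_act (q : Plaquette d L) (U : GaugeConfig d L (SUN N)) :
    (plaqFamilyI f a₀ lam hf hfconj hfosc hlam hflip q).act U = f q (plaquetteHolonomy U q.1 q.2.1.1 q.2.1.2) :=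
  congrArg (f q) (wordProd_plaqWord U q.1 q.2.1.1 q.2.1.2)

variable [NeZero L]

/-- **Total** of the inhomogeneous member: `∑_q f_q(U_q)`. [folklore] -/
theorem isPlaquetteFamilyAction_plaqFamilyI :
    IsPlaquetteFamilyAction f (termPerturbation (plaqFamilyI f a₀ lam hf hfconj hfosc hlam hflip)) := fun U => by
  rw [total_termPerturbation]
  exact sum_congr rfl fun q _ => plaqFamilyI_act f a₀ lam hf hfconj hfosc hlam hflip q U

end FamilyI

/-- **Inhomogeneous class-function plaquette actions are members of the carrier** (every torus): densities `f_q`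
continuous class functions with a common oscillation bound `a₀` and Frobenius-Lipschitz constant `λ ≥ 0`. [folklore] -/
theorem exists_plaquetteFamily_member [NeZero L] (f : Plaquette d L → SUN N → ℝ) (a₀ lam : ℝ)
    (hf : ∀ q, Continuous (f q)) (hfconj : ∀ q (g h : SUN N), f q (h * g * h⁻¹) = f q g)
    (hfosc : ∀ q x y, f q x - f q y ≤ a₀) (hlam : 0 ≤ lam) (hflip : ∀ q x y, |f q x - f q y| ≤ lam * suFrobDist x y) :
    ∃ W : Perturbation d L N, IsPlaquetteFamilyAction f W :=
  ⟨_, isPlaquetteFamilyAction_plaqFamilyI f a₀ lam hf hfconj hfosc hlam hflip⟩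

/-! ### Bond disorder: plaquette-dependent Wilson couplings -/

/-- **The detuning density** of a coupling field `δ : plaquettes → ℝ`: `f_q(g) = −δ_q · Re tr g`, so that
`e^{−W}` multiplies the Wilson weight `e^{β Re tr U_q}` of plaquette `q` by `e^{δ_q Re tr U_q}` — the SU(N) Wilson
action with INHOMOGENEOUS couplings `β + δ_q`. [folklore] -/
def detuneDensity (δ : Plaquette d L → ℝ) (q : Plaquette d L) (g : SUN N) : ℝ :=
  -δ q * (g : Matrix (Fin N) (Fin N) ℂ).trace.re

/-- `|detuneDensity δ q (centreOf s · g)| ≤ N · |δ_q|`. [folklore] -/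
theorem abs_detuneDensity_centreOf_mul_le [NeZero N] (δ : Plaquette d L → ℝ) (q : Plaquette d L) (s : ZMod N)
    (g : SUN N) : |detuneDensity δ q (centreOf s * g)| ≤ (N : ℝ) * |δ q| := by
  unfold detuneDensity
  rw [abs_mul, abs_neg, mul_comm]
  refine mul_le_mul_of_nonneg_right ((Complex.abs_re_le_norm _).trans (norm_trace_le _)) (abs_nonneg _)

/-- **Bond-disordered Wilson actions are flux-local**: a plaquette family action with the detuning densities of a
coupling field `|δ_q| ≤ δ` is flux-local with amplitude `N δ`. [folklore] -/
theorem isFluxLocal_of_detune [NeZero L] [NeZero N] {δ : Plaquette d L → ℝ} {δ₀ : ℝ} (hδ : ∀ q, |δ q| ≤ δ₀)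
    {W : Perturbation d L N} (hW : IsPlaquetteFamilyAction (detuneDensity δ) W) : IsFluxLocal ((N : ℝ) * δ₀) W :=
  isFluxLocal_of_plaquetteFamilyAction hW (fun _ _ => 0) fun q s g => by
    rw [sub_zero]
    exact (abs_detuneDensity_centreOf_mul_le δ q s g).trans (mul_le_mul_of_nonneg_left (hδ q) (Nat.cast_nonneg N))

/-- The detuning densities are continuous class functions with oscillation `≤ 2Nδ` and Frobenius-Lipschitz constant
`≤ √N δ` — the hypotheses of `plaqFamilyI`. [folklore] -/
theorem detuneDensity_loads {δ : Plaquette d L → ℝ} {δ₀ : ℝ} (hδ : ∀ q, |δ q| ≤ δ₀) :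
    (∀ q, Continuous (detuneDensity (N := N) δ q)) ∧
    (∀ q (g h : SUN N), detuneDensity δ q (h * g * h⁻¹) = detuneDensity δ q g) ∧
    (∀ q (x y : SUN N), detuneDensity δ q x - detuneDensity δ q y ≤ 2 * N * δ₀) ∧
    (∀ q (x y : SUN N), |detuneDensity δ q x - detuneDensity δ q y| ≤ Real.sqrt N * δ₀ * suFrobDist x y) := by
  refine ⟨fun q => ?_, fun q g h => ?_, fun q x y => ?_, fun q x y => ?_⟩
  · unfold detuneDensity
    exact continuous_const.mul (Complex.continuous_re.comp (Continuous.matrix_trace continuous_subtype_val))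
  · unfold detuneDensity
    have htr : ((h * g * h⁻¹ : SUN N) : Matrix (Fin N) (Fin N) ℂ).trace = (g : Matrix (Fin N) (Fin N) ℂ).trace := by
      rw [Submonoid.coe_mul, Submonoid.coe_mul, Matrix.trace_mul_cycle, ← Submonoid.coe_mul, inv_mul_cancel,
        OneMemClass.coe_one, one_mul]
    rw [htr]
  · have h := abs_sub_le_of_le hδ q x y
    exact (le_abs_self _).trans h
  · unfold detuneDensity
    rw [show -δ q * (x : Matrix (Fin N) (Fin N) ℂ).trace.re - -δ q * (y : Matrix (Fin N) (Fin N) ℂ).trace.re =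
      -δ q * ((x : Matrix (Fin N) (Fin N) ℂ).trace - (y : Matrix (Fin N) (Fin N) ℂ).trace).re by
        rw [Complex.sub_re]; ring, abs_mul, abs_neg]
    calc |δ q| * |((x : Matrix (Fin N) (Fin N) ℂ).trace - (y : Matrix (Fin N) (Fin N) ℂ).trace).re|
        ≤ δ₀ * (Real.sqrt N * suFrobDist x y) :=
          mul_le_mul (hδ q) ((Complex.abs_re_le_norm _).trans (norm_trace_sub_le_suFrobDist x y)) (abs_nonneg _)
            ((abs_nonneg _).trans (hδ q))
      _ = Real.sqrt N * δ₀ * suFrobDist x y := by ring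
where
  /-- oscillation of the detuning density. [folklore] -/
  abs_sub_le_of_le {δ : Plaquette d L → ℝ} {δ₀ : ℝ} (hδ : ∀ q, |δ q| ≤ δ₀) (q : Plaquette d L) (x y : SUN N) :
      |detuneDensity δ q x - detuneDensity δ q y| ≤ 2 * N * δ₀ := by
    unfold detuneDensity
    have hx : |(x : Matrix (Fin N) (Fin N) ℂ).trace.re| ≤ N := (Complex.abs_re_le_norm _).trans (norm_trace_le x)
    have hy : |(y : Matrix (Fin N) (Fin N) ℂ).trace.re| ≤ N := (Complex.abs_re_le_norm _).trans (norm_trace_le y)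
    rw [show -δ q * (x : Matrix (Fin N) (Fin N) ℂ).trace.re - -δ q * (y : Matrix (Fin N) (Fin N) ℂ).trace.re =
      -δ q * ((x : Matrix (Fin N) (Fin N) ℂ).trace.re - (y : Matrix (Fin N) (Fin N) ℂ).trace.re) by ring, abs_mul, abs_neg]
    calc |δ q| * |(x : Matrix (Fin N) (Fin N) ℂ).trace.re - (y : Matrix (Fin N) (Fin N) ℂ).trace.re|
        ≤ δ₀ * (N + N) := mul_le_mul (hδ q) ((abs_sub _ _).trans (add_le_add hx hy)) (abs_nonneg _)
            ((abs_nonneg _).trans (hδ q))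
      _ = 2 * N * δ₀ := by ring

/-- **Bond-disordered SU(N) Wilson actions exist in the carrier**: for every coupling field `|δ_q| ≤ δ` (`0 ≤ δ`)
and every torus there is a member `W_δ` with `W_δ.total U = −∑_q δ_q Re tr U_q`. [folklore] -/
theorem exists_detune_member [NeZero L] {δ : Plaquette d L → ℝ} {δ₀ : ℝ} (hδ₀ : 0 ≤ δ₀) (hδ : ∀ q, |δ q| ≤ δ₀) :
    ∃ W : Perturbation d L N, IsPlaquetteFamilyAction (detuneDensity δ) W := by
  obtain ⟨hc, hconj, hosc, hlip⟩ := detuneDensity_loads (N := N) hδ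
  exact exists_plaquetteFamily_member (detuneDensity δ) (2 * N * δ₀) (Real.sqrt N * δ₀) hc hconj hosc (by positivity)
    hlip

/-- **UNIFORM AREA LAW OVER BOND DISORDER** (`N ≥ 2`): for every coupling field `|δ_q| ≤ δ`, every twist-blind action
`W_b` (e.g. adjoint couplings of any strength), every member `W_δ` with the detuning densities, every torus and every
non-wrapping `R × T` loop, at `c = 2(d−1)N(|β| + δ) ≤ 1`:
`|⟨W_{R×T}⟩_{β, W_b + W_δ, L}| ≤ (4 c^T)^R` — ONE bound for ALL inhomogeneous SU(N) Wilson couplings `β + δ_q` in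
the window. [folklore] -/
theorem bondDisorder_wilsonLoop_le [NeZero L] [NeZero N] (hN : 2 ≤ N) {β δ₀ c : ℝ} {δ : Plaquette d L → ℝ}
    (hδ₀ : 0 ≤ δ₀) (hδ : ∀ q, |δ q| ≤ δ₀) (hc : 2 * ((d - 1 : ℕ) : ℝ) * N * (|β| + δ₀) ≤ c) (hc1 : c ≤ 1)
    {Wb Wδ : Perturbation d L N} (hb : IsTwistBlind Wb) (hW : IsPlaquetteFamilyAction (detuneDensity δ) Wδ)
    (x : Site d L) {i j : Fin d} (hij : i ≠ j) {R T : ℕ} (hR : 2 * R ≤ L) (hT : 2 * T ≤ L) :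
    |(Wb + Wδ).expectation (fundamentalRep (Fin N)) β (wilsonLoop (fundamentalRep (Fin N)) x i j R T)| ≤
      (4 * c ^ T) ^ R :=
  abs_wilsonLoop_le_of_isFluxLocal hN (a := (N : ℝ) * δ₀) (by positivity)
    (by rw [show |β| * (N : ℝ) + N * δ₀ = N * (|β| + δ₀) by ring, ← mul_assoc]; exact hc) hc1 (Wb + Wδ)
    (IsFluxLocal.twistBlind_add hb (isFluxLocal_of_detune hδ hW)) x hij hR hT

/-- **SU(2), `d = 4`, bond disorder cell**: every plaquette coupling `β_W(q) = 2(β + δ_q)` with `|β| + δ ≤ 1/16`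
(all Wilson couplings in `[0, 1/4]` when `β = δ = 1/32`, say), plus ANY twist-blind action: `|⟨W_{R×T}⟩| ≤ (4·(3/4)^T)^R`.
[folklore] -/
theorem su2_bondDisorder_wilsonLoop_le [NeZero L] {β δ₀ : ℝ} {δ : Plaquette 4 L → ℝ} (hδ₀ : 0 ≤ δ₀)
    (hδ : ∀ q, |δ q| ≤ δ₀) (h : |β| + δ₀ ≤ 1 / 16) {Wb Wδ : Perturbation 4 L 2} (hb : IsTwistBlind Wb)
    (hW : IsPlaquetteFamilyAction (detuneDensity δ) Wδ) (x : Site 4 L) {i j : Fin 4} (hij : i ≠ j) {R T : ℕ}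
    (hR : 2 * R ≤ L) (hT : 2 * T ≤ L) :
    |(Wb + Wδ).expectation (fundamentalRep (Fin 2)) β (wilsonLoop (fundamentalRep (Fin 2)) x i j R T)| ≤
      (4 * (3 / 4 : ℝ) ^ T) ^ R :=
  bondDisorder_wilsonLoop_le (le_refl 2) hδ₀ hδ (by push_cast; linarith) (by norm_num) hb hW x hij hR hT

end Summit.Ventures.YMGap.RobustBall

end
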